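import Literature.Topology.FourManifolds.SpikedLoop
import HarnessLib

/-!
# Spikes in a foreign frame: growing and removing the spikes away from the native rails

Topic `Literature/Topology/FourManifolds` (trunk T-4MAN). Fact seat
`provefact-Literature.Topology.FourManifolds.Knot.IsConnectedSum.isIsotopic` (Schubert's theorem),
geometric heart for rail knots. `SpikedLoop.lean` grows the two spikes of band-sum data `b` at the
scale `κ` inside the necked rail loop of `b` itself (`isIsotopic_neckKnot_spikeKnot`). The later
assembly needs the same move inside **foreign frames**: loops which agree with the necked rail
loop of `b` only near the crossing, on the support of the spikes, and elsewhere consist of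
foreign material (pieces of a second band-sum datum carried by a reflection, a tiny inserted
unit, …). This file isolates what the spike family needs from the rest of the loop.

* `b.spikeSupp κ` — the **support of the spikes**: the parameters of the two cores with blown-up
  parameter in `[1/8, 4]` (off it the spiked piece function is the necked one,
  `spikePiece_eq_neckPiece_of_not_mem_spikeSupp`).
* `b.IsSpikeForeign hcross κ x` — **foreign points**: the north pole, or `ψ⁻¹ y` with `y` farther
  than `9κ ‖frame‖` from `pZero`, or with first blow-up coordinate `≤ 1/16`.
* `b.IsNeckFrame hcross κ F` — **neck frames**: `C^∞` piece functions with the seam property whose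
  periodisation is a simple regular loop, equal to the necked piece function on the support of
  the spikes, and elsewhere either equal to it or foreign.
* `b.spikeFam hcross κ σ F u = F + (spikePiece u - neckPiece)` — the spike family over the frame;
  `frameKnot`, `spikedFrameKnot` and **the isotopy** `isIsotopic_frameKnot_spikedFrameKnot`
  (read backwards: the spikes of a spiked foreign frame can be removed).

The one new estimate is `blowUp_pieceLo_zero_ge`: on the support, for every family parameter,
the first blow-up coordinate of the spiked pieces is `≥ α - ε₁ (|α| + 1) ≥ 3/40 > 1/16` (second
flatness package with `ε₁ ≤ 1/100`), which separates the moving pieces from foreign points of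
the third kind; the first two kinds are separated by `norm_pieceLo_sub_pZero_le`
(`SpikedLoop.lean`), and native points by `spikePiece_ne_neckPiece` and `injOn_spikePiece`.

Everything is proved; no named facts are introduced.

## References

* M. W. Hirsch, *Differential Topology*, GTM 33, Springer (1976), Ch. 8 §1, Thm. 1.3 (isotopy
  extension). [HirschDT1976]
-/

open scoped Manifold ContDiff Topology Real
open Function Set Metric Filter

noncomputable section

namespace Literature.Topology.FourManifolds

/-- Local notation: `𝔼 n` is the model Euclidean space `EuclideanSpace ℝ (Fin n)`. -/
local notation "𝔼 " n:arg => EuclideanSpace ℝ (Fin n)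

/-- Local notation: `𝕊 n` is the unit sphere in `EuclideanSpace ℝ (Fin (n + 1))`. -/
local notation "𝕊 " n:arg => (Metric.sphere (0 : EuclideanSpace ℝ (Fin (n + 1))) 1)

attribute [local instance] fact_finrank_euclideanSpace_succ

open KnotsInBall

namespace BandData

variable {A B K : Knot} {avoid : Set (𝕊 3)} (b : BandData A B K avoid)
  (hcross : b.band ⁻¹' sphereEquator 2 ∩ squareNhd b.δ = {x ∈ squareNhd b.δ | x 0 = 2⁻¹})

/-! ### The support of the spikes -/

omit hcross in
/-- **The support of the spikes**: the parameters of the two closed cores with blown-up parameter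
in `[1/8, 4]`. [folklore] -/
def spikeSupp (κ : ℝ) : Set ℝ :=
  {t | t ∈ Icc (b.tcLo - b.epsLo / 8) (b.tcLo + b.epsLo / 8) ∧ b.alphaLo κ t ∈ Icc (1 / 8 : ℝ) 4} ∪
    {t | t ∈ Icc (b.tcHi - b.epsHi / 8) (b.tcHi + b.epsHi / 8) ∧ b.alphaHi κ t ∈ Icc (1 / 8 : ℝ) 4}

/-- The support of the spikes is closed. [folklore] -/
theorem isClosed_spikeSupp (κ : ℝ) : IsClosed (b.spikeSupp κ) :=
  ((isClosed_Icc.preimage continuous_id).inter (isClosed_Icc.preimage (b.contDiff_alphaLo κ).continuous)).union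
    ((isClosed_Icc.preimage continuous_id).inter (isClosed_Icc.preimage (b.contDiff_alphaHi κ).continuous))

/-- The support of the spikes lies in the spike set. [folklore] -/
theorem spikeSupp_subset_spikeSet (κ : ℝ) : b.spikeSupp κ ⊆ b.spikeSet κ := by
  rintro t (⟨ht, hα⟩ | ⟨ht, hα⟩)
  · exact Or.inl ⟨ht, ⟨by linarith [hα.1], by linarith [hα.2]⟩⟩
  · exact Or.inr ⟨ht, ⟨by linarith [hα.1], by linarith [hα.2]⟩⟩

/-- The support of the spikes lies in `[alo + seamEps, alo + 1 - seamEps]`. [folklore] -/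
theorem spikeSupp_subset (κ : ℝ) : b.spikeSupp κ ⊆ Icc (b.alo + b.seamEps) (b.alo + 1 - b.seamEps) :=
  (b.spikeSupp_subset_spikeSet κ).trans (b.spikeSet_subset κ)

section Scale

variable {hcross} {σ ε r A' κ : ℝ} (h : b.SpikeScale hcross σ ε r A' κ)
include h

/-- **Off the support the spiked piece function is the necked one** (every family parameter).
[folklore] -/
theorem spikePiece_eq_neckPiece_of_not_mem_spikeSupp (u : ℝ) {t : ℝ} (ht : t ∉ b.spikeSupp κ) :
    b.spikePiece hcross κ σ u t = b.neckPiece κ 1 t := by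
  by_cases hS : t ∈ b.spikeSet κ
  · rcases hS with ⟨hc, hα⟩ | ⟨hc, hα⟩
    · have hα' : b.alphaLo κ t ∉ Ioo (1 / 8 : ℝ) 4 := fun hm ↦ ht (Or.inl ⟨hc, ⟨hm.1.le, hm.2.le⟩⟩)
      rw [b.spikePiece_coreLo hcross h.κ_pos h.κ_le h.eight_le_poleRad σ u hc (b.abs_alphaLo_lt_of_mem hα),
        spikePtLo, b.pieceLo_eq_rail hcross hα']
      exact b.railPtLo_eq_neckPiece hcross h.κ_pos h.eight_le_poleRad hc (b.abs_alphaLo_lt_of_mem hα)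
    · have hα' : b.alphaHi κ t ∉ Ioo (1 / 8 : ℝ) 4 := fun hm ↦ ht (Or.inr ⟨hc, ⟨hm.1.le, hm.2.le⟩⟩)
      rw [b.spikePiece_coreHi hcross h.κ_pos h.κ_le h.eight_le_poleRad σ u hc (b.abs_alphaHi_lt_of_mem hα),
        spikePtHi, b.pieceHi_eq_rail hcross hα']
      exact b.railPtHi_eq_neckPiece hcross h.κ_pos h.eight_le_poleRad hc (b.abs_alphaHi_lt_of_mem hα)
  · exact b.spikePiece_eq_neckPiece' h u hS

end Scale

/-! ### Foreign points -/

/-- **Foreign points** for the spike construction at scale `κ`: the north pole, or `ψ⁻¹ y` with `y`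
farther than `9κ ‖frame‖` from `pZero` or with first blow-up coordinate `≤ 1/16`. [folklore] -/
def IsSpikeForeign (κ : ℝ) (x : 𝔼 4) : Prop :=
  x = ((northPole : 𝕊 3) : 𝔼 4) ∨
    ∃ y : 𝔼 3, x = ((psiN.symm y : 𝕊 3) : 𝔼 4) ∧
      (9 * κ * ‖((b.frame hcross : (𝔼 3) ≃L[ℝ] 𝔼 3) : (𝔼 3) →L[ℝ] 𝔼 3)‖ < ‖y - b.pZero‖ ∨
        b.blowUp hcross κ y 0 ≤ 1 / 16)

/-! ### The first blow-up coordinate on the support -/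

section FirstCoord

variable {hcross} {ε₁ r₁ κ : ℝ} (hf₁ : b.IsFlat hcross ε₁ r₁) (hκ : 0 < κ)
include hf₁ hκ

/-- **First blow-up coordinate of the lower spiked piece**: at least `α - ε₁ (|α| + 1)` for every
family parameter `u ∈ [0, 1]` (flat regime `κ (|α| + 1) < r₁`). [folklore] -/
theorem blowUp_pieceLo_zero_ge {u : ℝ} (hu : u ∈ Icc (0 : ℝ) 1) (σ : ℝ) {α : ℝ} (hsc : κ * (|α| + 1) < r₁) :
    α - ε₁ * (|α| + 1) ≤ b.blowUp hcross κ (b.pieceLo hcross κ σ u α) 0 := by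
  have h1 := b.norm_blowUp_railLoPsi_sub_le hf₁ hκ hsc
  have h2 : |b.blowUp hcross κ (b.railLoPsi κ α) 0 - α| ≤ ε₁ * (|α| + 1) := by
    have := PiLp.norm_apply_le (b.blowUp hcross κ (b.railLoPsi κ α) - pt3 α (-1) 0) 0
    simp only [PiLp.sub_apply, Real.norm_eq_abs] at this
    exact this.trans h1
  have hw := spikeBump_mem_Icc α
  have hw0 : 0 ≤ u * spikeBump α := mul_nonneg hu.1 hw.1
  have hw1 : u * spikeBump α ≤ 1 := mul_le_one₀ hu.2 hw.1 hw.2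
  rw [b.blowUp_pieceLo_zero hcross hκ.ne']
  have h3 : α - ε₁ * (|α| + 1) ≤ b.blowUp hcross κ (b.railLoPsi κ α) 0 := by linarith [(abs_le.1 h2).1]
  have hε : 0 ≤ ε₁ * (|α| + 1) := mul_nonneg hf₁.eps_nonneg (by positivity)
  nlinarith

/-- **First blow-up coordinate of the upper spiked piece**: at least `α - ε₁ (|α| + 1)`. [folklore] -/
theorem blowUp_pieceHi_zero_ge {u : ℝ} (hu : u ∈ Icc (0 : ℝ) 1) (σ : ℝ) {α : ℝ} (hsc : κ * (|α| + 1) < r₁) :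
    α - ε₁ * (|α| + 1) ≤ b.blowUp hcross κ (b.pieceHi hcross κ σ u α) 0 := by
  have h1 := b.norm_blowUp_railHiPsi_sub_le hf₁ hκ hsc
  have h2 : |b.blowUp hcross κ (b.railHiPsi κ α) 0 - α| ≤ ε₁ * (|α| + 1) := by
    have := PiLp.norm_apply_le (b.blowUp hcross κ (b.railHiPsi κ α) - pt3 α 1 0) 0
    simp only [PiLp.sub_apply, Real.norm_eq_abs] at this
    exact this.trans h1
  have hw := spikeBump_mem_Icc α
  have hw0 : 0 ≤ u * spikeBump α := mul_nonneg hu.1 hw.1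
  have hw1 : u * spikeBump α ≤ 1 := mul_le_one₀ hu.2 hw.1 hw.2
  rw [b.blowUp_pieceHi_zero hcross hκ.ne']
  have h3 : α - ε₁ * (|α| + 1) ≤ b.blowUp hcross κ (b.railHiPsi κ α) 0 := by linarith [(abs_le.1 h2).1]
  have hε : 0 ≤ ε₁ * (|α| + 1) := mul_nonneg hf₁.eps_nonneg (by positivity)
  nlinarith

/-- On the support (`α ∈ [1/8, 4]`), with `ε₁ ≤ 1/100` and `5κ < r₁`, the first blow-up coordinate
of the lower spiked piece exceeds `1/16`. [folklore] -/
theorem blowUp_pieceLo_zero_gt (hε₁ : ε₁ ≤ 1 / 100) (hr₁ : 5 * κ < r₁) {u : ℝ} (hu : u ∈ Icc (0 : ℝ) 1) (σ : ℝ)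
    {α : ℝ} (hα : α ∈ Icc (1 / 8 : ℝ) 4) : 1 / 16 < b.blowUp hcross κ (b.pieceLo hcross κ σ u α) 0 := by
  have habs : |α| = α := abs_of_pos (by linarith [hα.1])
  have hsc : κ * (|α| + 1) < r₁ := by rw [habs]; nlinarith [hα.2]
  have h1 := b.blowUp_pieceLo_zero_ge hf₁ hκ hu σ hsc
  rw [habs] at h1
  have hε0 := hf₁.eps_nonneg
  nlinarith [hα.1, hα.2]

/-- On the support the first blow-up coordinate of the upper spiked piece exceeds `1/16`.
[folklore] -/
theorem blowUp_pieceHi_zero_gt (hε₁ : ε₁ ≤ 1 / 100) (hr₁ : 5 * κ < r₁) {u : ℝ} (hu : u ∈ Icc (0 : ℝ) 1) (σ : ℝ)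
    {α : ℝ} (hα : α ∈ Icc (1 / 8 : ℝ) 4) : 1 / 16 < b.blowUp hcross κ (b.pieceHi hcross κ σ u α) 0 := by
  have habs : |α| = α := abs_of_pos (by linarith [hα.1])
  have hsc : κ * (|α| + 1) < r₁ := by rw [habs]; nlinarith [hα.2]
  have h1 := b.blowUp_pieceHi_zero_ge hf₁ hκ hu σ hsc
  rw [habs] at h1
  have hε0 := hf₁.eps_nonneg
  nlinarith [hα.1, hα.2]

end FirstCoord

/-! ### The spiked pieces avoid foreign points -/

section Foreign

variable {hcross} {σ ε r A' κ ε₁ r₁ : ℝ} (h : b.SpikeScale hcross σ ε r A' κ)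
  (hf₁ : b.IsFlat hcross ε₁ r₁) (hε₁ : ε₁ ≤ 1 / 100) (hr₁ : 5 * κ < r₁)
include h hf₁ hε₁ hr₁

/-- **The spiked pieces on the support avoid every foreign point** (`u ∈ [0, 1]`). [folklore] -/
theorem spikePiece_ne_of_isSpikeForeign {u : ℝ} (hu : u ∈ Icc (0 : ℝ) 1) {s : ℝ} (hs : s ∈ b.spikeSupp κ)
    {x : 𝔼 4} (hx : b.IsSpikeForeign hcross κ x) : b.spikePiece hcross κ σ u s ≠ x := by
  have hκ := h.κ_pos
  -- the moving point is `ψ⁻¹ y` with `y` close to `pZero` and first blow-up coordinate `> 1/16`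
  obtain ⟨y, hPy, hy, hfirst⟩ : ∃ y : 𝔼 3, b.spikePiece hcross κ σ u s = ((psiN.symm y : 𝕊 3) : 𝔼 4) ∧
      ‖y - b.pZero‖ ≤ 9 * κ * ‖((b.frame hcross : (𝔼 3) ≃L[ℝ] 𝔼 3) : (𝔼 3) →L[ℝ] 𝔼 3)‖ ∧
      1 / 16 < b.blowUp hcross κ y 0 := by
    rcases hs with ⟨hc, hα⟩ | ⟨hc, hα⟩
    · have hα' : b.alphaLo κ s ∈ Icc (-1 : ℝ) 6 := ⟨by linarith [hα.1], by linarith [hα.2]⟩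
      exact ⟨_, b.spikePiece_coreLo hcross hκ h.κ_le h.eight_le_poleRad σ u hc (b.abs_alphaLo_lt_of_mem hα'),
        b.norm_pieceLo_sub_pZero_le h hu hα', b.blowUp_pieceLo_zero_gt hf₁ hκ hε₁ hr₁ hu σ hα⟩
    · have hα' : b.alphaHi κ s ∈ Icc (-1 : ℝ) 6 := ⟨by linarith [hα.1], by linarith [hα.2]⟩
      exact ⟨_, b.spikePiece_coreHi hcross hκ h.κ_le h.eight_le_poleRad σ u hc (b.abs_alphaHi_lt_of_mem hα'),
        b.norm_pieceHi_sub_pZero_le h hu hα', b.blowUp_pieceHi_zero_gt hf₁ hκ hε₁ hr₁ hu σ hα⟩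
  rw [hPy]
  rcases hx with rfl | ⟨y', rfl, hy'⟩
  · exact fun heq ↦ psiN_symm_ne_northPole y (Subtype.ext heq)
  · intro heq
    have hyy : y = y' := coe_psiN_symm_injective heq
    subst hyy
    rcases hy' with hfar | hsmall
    · linarith
    · linarith

end Foreign

/-! ### Neck frames and the spike family over a frame -/

omit hcross in
/-- **The agreement set**: the parameters of the two closed cores with blown-up parameter in
`[1/16, 5]` (a closed set containing a neighbourhood of the support of the spikes). [folklore] -/
def spikeAgree (κ : ℝ) : Set ℝ :=
  {t | t ∈ Icc (b.tcLo - b.epsLo / 8) (b.tcLo + b.epsLo / 8) ∧ b.alphaLo κ t ∈ Icc (1 / 16 : ℝ) 5} ∪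
    {t | t ∈ Icc (b.tcHi - b.epsHi / 8) (b.tcHi + b.epsHi / 8) ∧ b.alphaHi κ t ∈ Icc (1 / 16 : ℝ) 5}

/-- The support of the spikes lies in the agreement set. [folklore] -/
theorem spikeSupp_subset_spikeAgree (κ : ℝ) : b.spikeSupp κ ⊆ b.spikeAgree κ := by
  rintro t (⟨ht, hα⟩ | ⟨ht, hα⟩)
  · exact Or.inl ⟨ht, ⟨by linarith [hα.1], by linarith [hα.2]⟩⟩
  · exact Or.inr ⟨ht, ⟨by linarith [hα.1], by linarith [hα.2]⟩⟩

/-- The agreement set lies in the spike set. [folklore] -/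
theorem spikeAgree_subset_spikeSet (κ : ℝ) : b.spikeAgree κ ⊆ b.spikeSet κ := by
  rintro t (⟨ht, hα⟩ | ⟨ht, hα⟩)
  · exact Or.inl ⟨ht, ⟨by linarith [hα.1], by linarith [hα.2]⟩⟩
  · exact Or.inr ⟨ht, ⟨by linarith [hα.1], by linarith [hα.2]⟩⟩

/-- **Neck frames** of `b` at scale `κ`: a `C^∞` piece function with the seam property at `b.alo`,
whose periodisation is a regular loop, injective on the fundamental domain, equal to the necked
piece function on the agreement set, and whose other points of the fundamental domain off the
support are native (the necked piece function) or foreign. [folklore] -/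
structure IsNeckFrame (κ : ℝ) (F : ℝ → 𝔼 4) : Prop where
  contDiff : ContDiff ℝ ∞ F
  seam : ∀ t ∈ Ioo (b.alo - b.seamEps) (b.alo + b.seamEps), F (t + 1) = F t
  isRegularLoop : IsRegularLoop (periodise b.alo F)
  injOn : InjOn F (Ico b.alo (b.alo + 1))
  agree : ∀ t ∈ b.spikeAgree κ, F t = b.neckPiece κ 1 t
  rest : ∀ t ∈ Ico b.alo (b.alo + 1), t ∉ b.spikeSupp κ →
    F t = b.neckPiece κ 1 t ∨ b.IsSpikeForeign hcross κ (F t)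

variable {b hcross} in
/-- **The knot of a neck frame.** [folklore] -/
def IsNeckFrame.frameKnot {κ : ℝ} {F : ℝ → 𝔼 4} (hF : b.IsNeckFrame hcross κ F) : Knot :=
  hF.isRegularLoop.toKnot (periodise_simple_iff.2 hF.injOn)

variable {b hcross} in
/-- The knot of a neck frame on the circle point of parameter `t`. [folklore] -/
theorem IsNeckFrame.coe_frameKnot_circlePt {κ : ℝ} {F : ℝ → 𝔼 4} (hF : b.IsNeckFrame hcross κ F) (t : ℝ) :
    ((hF.frameKnot (circlePt t) : 𝕊 3) : 𝔼 4) = periodise b.alo F t :=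
  hF.isRegularLoop.coe_toKnot_circlePt _ t

/-- **The spike family over a frame**: `F + (spikePiece u - neckPiece)`. [folklore] -/
def spikeFam (κ σ : ℝ) (F : ℝ → 𝔼 4) (u t : ℝ) : 𝔼 4 :=
  F t + (b.spikePiece hcross κ σ u t - b.neckPiece κ 1 t)

/-- At `u = 0` the family is the frame. [folklore] -/
theorem spikeFam_zero (κ σ : ℝ) (F : ℝ → 𝔼 4) (t : ℝ) : b.spikeFam hcross κ σ F 0 t = F t := by
  rw [spikeFam, b.spikePiece_zero hcross κ σ, sub_self, add_zero]

/-- Where the frame is native the family is the spiked piece function. [folklore] -/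
theorem spikeFam_of_eq (κ σ : ℝ) {F : ℝ → 𝔼 4} (u : ℝ) {t : ℝ} (ht : F t = b.neckPiece κ 1 t) :
    b.spikeFam hcross κ σ F u t = b.spikePiece hcross κ σ u t := by
  rw [spikeFam, ht]; abel

section Frame

variable {hcross} {σ ε r A' κ : ℝ}

/-- **The agreement set is a neighbourhood of every point of the support** (`7κ ≤ gapLo, gapHi`).
[folklore] -/
theorem eventually_mem_spikeAgree (hκ : 0 < κ) (h7 : 7 * κ ≤ b.gapLo) (h7' : 7 * κ ≤ b.gapHi) {t : ℝ}
    (ht : t ∈ b.spikeSupp κ) : ∀ᶠ t' in 𝓝 t, t' ∈ b.spikeAgree κ := by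
  rcases ht with ⟨hc, hα⟩ | ⟨hc, hα⟩
  · have hα' : b.alphaLo κ t ∈ Icc (-1 : ℝ) 6 := ⟨by linarith [hα.1], by linarith [hα.2]⟩
    have hcore := b.mem_openCoreLo hκ h7 hα'
    have hopen : IsOpen (Ioo (b.tcLo - b.epsLo / 8) (b.tcLo + b.epsLo / 8) ∩ b.alphaLo κ ⁻¹' Ioo (1 / 16 : ℝ) 5) :=
      isOpen_Ioo.inter (isOpen_Ioo.preimage (b.contDiff_alphaLo κ).continuous)
    filter_upwards [hopen.mem_nhds ⟨hcore, ⟨by linarith [hα.1], by linarith [hα.2]⟩⟩] with t' ht'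
    exact Or.inl ⟨Ioo_subset_Icc_self ht'.1, Ioo_subset_Icc_self ht'.2⟩
  · have hα' : b.alphaHi κ t ∈ Icc (-1 : ℝ) 6 := ⟨by linarith [hα.1], by linarith [hα.2]⟩
    have hcore := b.mem_openCoreHi hκ h7' hα'
    have hopen : IsOpen (Ioo (b.tcHi - b.epsHi / 8) (b.tcHi + b.epsHi / 8) ∩ b.alphaHi κ ⁻¹' Ioo (1 / 16 : ℝ) 5) :=
      isOpen_Ioo.inter (isOpen_Ioo.preimage (b.contDiff_alphaHi κ).continuous)
    filter_upwards [hopen.mem_nhds ⟨hcore, ⟨by linarith [hα.1], by linarith [hα.2]⟩⟩] with t' ht'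
    exact Or.inr ⟨Ioo_subset_Icc_self ht'.1, Ioo_subset_Icc_self ht'.2⟩

variable (h : b.SpikeScale hcross σ ε r A' κ) {F : ℝ → 𝔼 4} (hF : b.IsNeckFrame hcross κ F)
include h

/-- Off the support the family is the frame. [folklore] -/
theorem spikeFam_of_not_mem (F : ℝ → 𝔼 4) (u : ℝ) {t : ℝ} (ht : t ∉ b.spikeSupp κ) :
    b.spikeFam hcross κ σ F u t = F t := by
  rw [spikeFam, b.spikePiece_eq_neckPiece_of_not_mem_spikeSupp h u ht, sub_self, add_zero]

include hF

omit h in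
/-- On the support the family is the spiked piece function. [folklore] -/
theorem spikeFam_of_mem (u : ℝ) {t : ℝ} (ht : t ∈ b.spikeSupp κ) :
    b.spikeFam hcross κ σ F u t = b.spikePiece hcross κ σ u t :=
  b.spikeFam_of_eq hcross κ σ u (hF.agree t (b.spikeSupp_subset_spikeAgree κ ht))

/-- Near a point of the support the family is the spiked piece function. [folklore] -/
theorem spikeFam_eventuallyEq (u : ℝ) {t : ℝ} (ht : t ∈ b.spikeSupp κ) :
    b.spikeFam hcross κ σ F u =ᶠ[𝓝 t] b.spikePiece hcross κ σ u := by
  filter_upwards [b.eventually_mem_spikeAgree h.κ_pos h.seven_le_gapLo h.seven_le_gapHi ht] with t' ht'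
  exact b.spikeFam_of_eq hcross κ σ u (hF.agree t' ht')

/-- The family is jointly `C^∞`. [folklore] -/
theorem contDiff_spikeFam : ContDiff ℝ ∞ (uncurry (b.spikeFam hcross κ σ F)) := by
  have h1 : ContDiff ℝ ∞ (fun p : ℝ × ℝ ↦ F p.2) := hF.contDiff.comp contDiff_snd
  have h2 : ContDiff ℝ ∞ (uncurry (b.spikePiece hcross κ σ)) := b.contDiff_spikePiece hcross h.κ_pos h.eight_le_poleRad σ
  have h3 : ContDiff ℝ ∞ (fun p : ℝ × ℝ ↦ b.neckPiece κ 1 p.2) :=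
    (b.contDiff_neckPiece κ).comp ((contDiff_const (c := (1 : ℝ))).prodMk contDiff_snd)
  exact h1.add (h2.sub h3)

/-- **The loops of the family are regular** (`u ∈ [0, 1]`). [folklore] -/
theorem isRegularLoop_spikeFam {u : ℝ} (hu : u ∈ Icc (0 : ℝ) 1) :
    IsRegularLoop (periodise b.alo (b.spikeFam hcross κ σ F u)) :=
  hF.isRegularLoop.periodise_of_eqOn_compl
    ((b.contDiff_spikeFam h hF).comp (contDiff_const.prodMk contDiff_id)) b.seamEps_bounds.1 hF.seam
    (b.spikeSupp_subset κ) (b.isClosed_spikeSupp κ) (fun _ ht ↦ b.spikeFam_of_not_mem h F u ht)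
    (fun t ht ↦ by
      rw [b.spikeFam_of_mem hF u ht]
      exact b.norm_spikePiece hcross h.κ_pos h.κ_le h.eight_le_poleRad σ u (b.spikeSupp_subset_spikeSet κ ht))
    (fun t ht ↦ by
      rw [(b.spikeFam_eventuallyEq h hF u ht).deriv_eq]
      exact b.deriv_spikePiece_ne_zero h.flat h.κ_pos h.κ_le h.eight_le_poleRad h.eight_lt_r h.seven_le_gapLo
        h.seven_le_gapHi h.good8 hu (b.spikeSupp_subset_spikeSet κ ht))

/-- The family is injective on the support (`u ∈ [0, 1]`). [folklore] -/
theorem injOn_spikeFam_spikeSupp {u : ℝ} (hu : u ∈ Icc (0 : ℝ) 1) : InjOn (b.spikeFam hcross κ σ F u) (b.spikeSupp κ) := by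
  intro s hs t ht hst
  rw [b.spikeFam_of_mem hF u hs, b.spikeFam_of_mem hF u ht] at hst
  exact b.injOn_spikePiece h.flat h.κ_pos h.κ_le h.eight_le_poleRad h.eight_lt_r h.good8 h.eps8 hu
    (b.spikeSupp_subset_spikeSet κ hs) (b.spikeSupp_subset_spikeSet κ ht) hst

variable {ε₁ r₁ : ℝ} (hf₁ : b.IsFlat hcross ε₁ r₁) (hε₁ : ε₁ ≤ 1 / 100) (hr₁ : 5 * κ < r₁)
include hf₁ hε₁ hr₁

/-- **The family avoids the frame off the support** (`u ∈ [0, 1]`). [folklore] -/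
theorem spikeFam_ne {u : ℝ} (hu : u ∈ Icc (0 : ℝ) 1) {s : ℝ} (hs : s ∈ b.spikeSupp κ) {t : ℝ}
    (ht : t ∈ Ico b.alo (b.alo + 1)) (hts : t ∉ b.spikeSupp κ) : b.spikeFam hcross κ σ F u s ≠ F t := by
  rw [b.spikeFam_of_mem hF u hs]
  rcases hF.rest t ht hts with hnat | hfor
  · rw [hnat]
    by_cases htS : t ∈ b.spikeSet κ
    · -- native, inside the spike set: injectivity of the spiked piece function there
      rw [← b.spikePiece_eq_neckPiece_of_not_mem_spikeSupp h u hts]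
      intro he
      have hst : s = t := b.injOn_spikePiece h.flat h.κ_pos h.κ_le h.eight_le_poleRad h.eight_lt_r h.good8 h.eps8 hu
        (b.spikeSupp_subset_spikeSet κ hs) htS he
      exact hts (hst ▸ hs)
    · exact b.spikePiece_ne_neckPiece h hu (b.spikeSupp_subset_spikeSet κ hs) ht htS
  · exact b.spikePiece_ne_of_isSpikeForeign h hf₁ hε₁ hr₁ hu hs hfor

/-- **The loops of the family are injective on the fundamental domain** (`u ∈ [0, 1]`). [folklore] -/
theorem injOn_spikeFam {u : ℝ} (hu : u ∈ Icc (0 : ℝ) 1) : InjOn (b.spikeFam hcross κ σ F u) (Ico b.alo (b.alo + 1)) :=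
  injOn_Ico_of_eqOn_compl hF.injOn (fun _ ht ↦ b.spikeFam_of_not_mem h F u ht) (b.injOn_spikeFam_spikeSupp h hF hu)
    (fun _ hs _ ht hts ↦ b.spikeFam_ne h hF hf₁ hε₁ hr₁ hu hs ht hts)

/-- **The spiked frame knot**: the knot of the family at `u = 1`. [folklore] -/
def spikedFrameKnot : Knot :=
  (b.isRegularLoop_spikeFam h hF ⟨zero_le_one, le_rfl⟩).toKnot
    (periodise_simple_iff.2 (b.injOn_spikeFam h hF hf₁ hε₁ hr₁ ⟨zero_le_one, le_rfl⟩))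

/-- The spiked frame knot on the circle point of parameter `t`. [folklore] -/
theorem coe_spikedFrameKnot_circlePt (t : ℝ) :
    ((b.spikedFrameKnot h hF hf₁ hε₁ hr₁ (circlePt t) : 𝕊 3) : 𝔼 4) = periodise b.alo (b.spikeFam hcross κ σ F 1) t :=
  (b.isRegularLoop_spikeFam h hF ⟨zero_le_one, le_rfl⟩).coe_toKnot_circlePt _ t

/-- **THE SPIKES IN A FOREIGN FRAME.** The knot of a neck frame is isotopic to the spiked frame knot
(a smooth family of modifications on the support of the spikes; isotopy extension).
[cite: HirschDT1976, Ch. 8 §1, Thm. 1.3] -/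
theorem isIsotopic_frameKnot_spikedFrameKnot :
    hF.frameKnot.IsIsotopic (b.spikedFrameKnot h hF hf₁ hε₁ hr₁) :=
  IsRegularLoop.isIsotopic_of_modification (G := b.spikeFam hcross κ σ F)
    hF.isRegularLoop hF.injOn
    (b.isRegularLoop_spikeFam h hF ⟨zero_le_one, le_rfl⟩) (b.injOn_spikeFam h hF hf₁ hε₁ hr₁ ⟨zero_le_one, le_rfl⟩)
    b.seamEps_bounds.1 hF.seam (b.contDiff_spikeFam h hF)
    (b.spikeSupp_subset κ) (b.isClosed_spikeSupp κ) (fun u _ ht ↦ b.spikeFam_of_not_mem h F u ht)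
    (b.spikeFam_zero hcross κ σ F)
    (fun u _ _ ht ↦ by
      rw [b.spikeFam_of_mem hF u ht]
      exact b.norm_spikePiece hcross h.κ_pos h.κ_le h.eight_le_poleRad σ u (b.spikeSupp_subset_spikeSet κ ht))
    (fun u hu _ ht ↦ by
      rw [(b.spikeFam_eventuallyEq h hF u ht).deriv_eq]
      exact b.deriv_spikePiece_ne_zero h.flat h.κ_pos h.κ_le h.eight_le_poleRad h.eight_lt_r h.seven_le_gapLo
        h.seven_le_gapHi h.good8 hu (b.spikeSupp_subset_spikeSet κ ht))
    (fun _ hu ↦ b.injOn_spikeFam_spikeSupp h hF hu)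
    (fun _ hu _ hs _ ht hts ↦ b.spikeFam_ne h hF hf₁ hε₁ hr₁ hu hs ht hts)

end Frame

end BandData

end Literature.Topology.FourManifolds
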